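import Summits.CriticalPhenomena.PercolationContinuityZ3.Theorems.PercNearOneGluingNoHeavyLowerTailSahiCombTriWPrincipalCor

/-!
# The shell dichotomy: an up-set with `Cor_P ≥ 0` is antipode-free or the whole cube

Support file of the one-cut programme (crux `NoHeavyLowerTail`, stmt-CriticalPhenomena-4575; unit `prim-lf-1` gen 58, memo
`FROM-prim-lf-1-gen58-Q311-LEAN-AND-PROFILE-NOGO.md` §2b).  The census of that memo lists the "good" up-sets `Q ⊆ 2^{Fin 5}` (up-sets
with `Cor_Q(A,B) ≥ 0` for all up-sets `A, B`): they are the 27 INTERSECTING good up-sets plus the full cube, and nothing else.  The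
structural reason is the one-pair test recorded here, valid in every dimension:

* `corP_upGen_upGen_compl` : `Cor_P(↑y, ↑yᶜ) = [⊤ ∈ P] + [∅ ∈ P] − [y ∈ P] − [yᶜ ∈ P]` — the only points `w` at which the pair
  summand `s_{↑y}(w)·s_{↑yᶜ}(w)` is non-zero are `⊤, ∅` (value `+1`) and `y, yᶜ` (value `−1`);
* `empty_mem_of_corP_nonneg_of_compl_mem`, `eq_univ_of_corP_nonneg_of_compl_mem` : if `P` contains an antipodal pair `y, yᶜ`
  and passes the test `Cor_P(↑y, ↑yᶜ) ≥ 0`, then `∅ ∈ P`, so an up-set `P` is the whole cube;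
* `inter_refl_eq_empty_or_eq_univ_of_corP_nonneg` : **DICHOTOMY** — an up-set `P` with `Cor_P ≥ 0` on all pairs of (principal)
  up-sets is either antipode-free (`P ∩ refl P = ∅`, an intersecting Kleitman shell) or `univ` (the full cube, which is a shell by
  `corP_univ_nonneg`).
So "good" needs no separate treatment of non-intersecting families: the AND-product programme (`…TriWAnd*`) loses nothing by assuming
`Disjoint P₁ (refl P₁)`.
HONEST LABEL: complete proofs, std axioms; an elementary structural lemma (one Kleitman test pair). [this work]
-/

namespace Summit.CriticalPhenomena.PercolationContinuityZ3.Theorems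

namespace FiveUpSet

open Finset

variable {γ : Type} [DecidableEq γ] [Fintype γ]

/-! ### The four intersections of `↑y`, `↑yᶜ` and their antipodal images -/

/-- `↑y ∩ ↑yᶜ = {⊤}`. [this work] -/
theorem upGen_inter_upGen_compl (y : Finset γ) : upGen y ∩ upGen yᶜ = {univ} := by
  ext w
  simp only [mem_inter, mem_upGen, mem_singleton]
  constructor
  · rintro ⟨h1, h2⟩
    exact eq_univ_of_forall fun a => by
      by_cases ha : a ∈ y
      · exact h1 ha
      · exact h2 (mem_compl.2 ha)
  · rintro rfl
    exact ⟨subset_univ _, subset_univ _⟩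

/-- `refl ↑y = {w | y ⊆ wᶜ}`: membership. [this work] -/
theorem mem_refl_upGen {y w : Finset γ} : w ∈ refl (upGen y) ↔ y ⊆ wᶜ := by
  rw [mem_refl, mem_upGen]

/-- `↑y ∩ refl ↑yᶜ = {y}`. [this work] -/
theorem upGen_inter_refl_upGen_compl (y : Finset γ) : upGen y ∩ refl (upGen yᶜ) = {y} := by
  ext w
  simp only [mem_inter, mem_upGen, mem_refl_upGen, mem_singleton, compl_subset_compl]
  constructor
  · rintro ⟨h1, h2⟩
    exact Subset.antisymm h2 h1
  · rintro rfl
    exact ⟨Subset.rfl, Subset.rfl⟩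

/-- `refl ↑y ∩ ↑yᶜ = {yᶜ}`. [this work] -/
theorem refl_upGen_inter_upGen_compl (y : Finset γ) : refl (upGen y) ∩ upGen yᶜ = {yᶜ} := by
  ext w
  simp only [mem_inter, mem_upGen, mem_refl_upGen, mem_singleton]
  constructor
  · rintro ⟨h1, h2⟩
    refine Subset.antisymm ?_ h2
    intro a ha
    rw [mem_compl]
    intro hay
    exact (mem_compl.1 (h1 hay)) ha
  · rintro rfl
    exact ⟨by rw [compl_compl], Subset.rfl⟩

/-- `refl ↑y ∩ refl ↑yᶜ = {∅}`. [this work] -/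
theorem refl_upGen_inter_refl_upGen_compl (y : Finset γ) : refl (upGen y) ∩ refl (upGen yᶜ) = {∅} := by
  rw [← refl_inter, upGen_inter_upGen_compl]
  ext w
  simp only [mem_refl, mem_singleton]
  constructor
  · intro h
    have h' : wᶜᶜ = univᶜ := by rw [h]
    rwa [compl_compl, compl_univ] at h'
  · rintro rfl
    exact compl_empty

omit [Fintype γ] in
/-- `#(P ∩ {a}) = [a ∈ P]`. [this work] -/
theorem card_inter_singleton_eq_ite (P : Finset (Finset γ)) (a : Finset γ) :
    ((P ∩ {a}).card : ℤ) = if a ∈ P then 1 else 0 := by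
  by_cases h : a ∈ P
  · rw [inter_singleton_of_mem h, card_singleton, if_pos h]; rfl
  · rw [inter_singleton_of_notMem h, card_empty, if_neg h]; rfl

/-! ### The one-pair test and the dichotomy -/

/-- **`Cor_P(↑y, ↑yᶜ) = [⊤ ∈ P] + [∅ ∈ P] − [y ∈ P] − [yᶜ ∈ P]`** for every family `P` and every `y`. [this work] -/
theorem corP_upGen_upGen_compl (P : Finset (Finset γ)) (y : Finset γ) :
    corP P (upGen y) (upGen yᶜ) =
      (if univ ∈ P then 1 else 0) + (if (∅ : Finset γ) ∈ P then 1 else 0) - (if y ∈ P then 1 else 0) - (if yᶜ ∈ P then 1 else 0) := by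
  unfold corP
  rw [inter_assoc, inter_assoc, inter_assoc, inter_assoc, upGen_inter_upGen_compl, refl_upGen_inter_refl_upGen_compl,
    upGen_inter_refl_upGen_compl, refl_upGen_inter_upGen_compl, card_inter_singleton_eq_ite, card_inter_singleton_eq_ite,
    card_inter_singleton_eq_ite, card_inter_singleton_eq_ite]

/-- If `P` passes the single test `Cor_P(↑y, ↑yᶜ) ≥ 0` for an antipodal pair `y, yᶜ ∈ P`, then `∅ ∈ P`. [this work] -/
theorem empty_mem_of_corP_nonneg_of_compl_mem {P : Finset (Finset γ)} {y : Finset γ} (hy : y ∈ P) (hyc : yᶜ ∈ P)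
    (hcor : 0 ≤ corP P (upGen y) (upGen yᶜ)) : (∅ : Finset γ) ∈ P := by
  rw [corP_upGen_upGen_compl, if_pos hy, if_pos hyc] at hcor
  by_contra h
  rw [if_neg h] at hcor
  by_cases hu : univ ∈ P
  · rw [if_pos hu] at hcor; omega
  · rw [if_neg hu] at hcor; omega

/-- An UP-SET `P` containing an antipodal pair `y, yᶜ` and passing the test `Cor_P(↑y, ↑yᶜ) ≥ 0` is the whole cube. [this work] -/
theorem eq_univ_of_corP_nonneg_of_compl_mem {P : Finset (Finset γ)} (hP : IsUpperSet (P : Set (Finset γ))) {y : Finset γ}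
    (hy : y ∈ P) (hyc : yᶜ ∈ P) (hcor : 0 ≤ corP P (upGen y) (upGen yᶜ)) : P = univ := by
  have h0 : (∅ : Finset γ) ∈ P := empty_mem_of_corP_nonneg_of_compl_mem hy hyc hcor
  exact eq_univ_of_forall fun t => hP (empty_subset t) h0

/-- **SHELL DICHOTOMY.**  An up-set `P` with `Cor_P(A,B) ≥ 0` for all up-sets `A, B` is either ANTIPODE-FREE (`P ∩ refl P = ∅`: an intersecting
Kleitman shell) or the FULL CUBE.  (Only the principal test pairs `(↑y, ↑yᶜ)` are used.) [this work] -/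
theorem inter_refl_eq_empty_or_eq_univ_of_corP_nonneg {P : Finset (Finset γ)} (hP : IsUpperSet (P : Set (Finset γ)))
    (hcor : ∀ A B : Finset (Finset γ), IsUpperSet (A : Set (Finset γ)) → IsUpperSet (B : Set (Finset γ)) → 0 ≤ corP P A B) :
    P ∩ refl P = ∅ ∨ P = univ := by
  by_cases h : P ∩ refl P = ∅
  · exact Or.inl h
  · right
    obtain ⟨y, hy⟩ := nonempty_iff_ne_empty.2 h
    rw [mem_inter, mem_refl] at hy
    exact eq_univ_of_corP_nonneg_of_compl_mem hP hy.1 hy.2 (hcor _ _ (isUpperSet_upGen y) (isUpperSet_upGen yᶜ))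

/-- The same dichotomy with the antipode-free branch stated as `Disjoint P (refl P)` (the hypothesis of the `…TriWAnd*` block theorems). [this work] -/
theorem disjoint_refl_or_eq_univ_of_corP_nonneg {P : Finset (Finset γ)} (hP : IsUpperSet (P : Set (Finset γ)))
    (hcor : ∀ A B : Finset (Finset γ), IsUpperSet (A : Set (Finset γ)) → IsUpperSet (B : Set (Finset γ)) → 0 ≤ corP P A B) :
    Disjoint P (refl P) ∨ P = univ := by
  rcases inter_refl_eq_empty_or_eq_univ_of_corP_nonneg hP hcor with h | h
  · exact Or.inl (disjoint_iff_inter_eq_empty.2 h)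
  · exact Or.inr h

/-- Conversely both branches are shells: the full cube has `Cor_univ ≥ 0` (`corP_univ_nonneg`, Kleitman), so for an up-set `P` that is NOT
antipode-free, `Cor_P ≥ 0` on all pairs of up-sets holds iff `P = univ`. [this work] -/
theorem corP_nonneg_iff_eq_univ_of_not_disjoint {P : Finset (Finset γ)} (hP : IsUpperSet (P : Set (Finset γ))) (hnd : ¬ Disjoint P (refl P)) :
    (∀ A B : Finset (Finset γ), IsUpperSet (A : Set (Finset γ)) → IsUpperSet (B : Set (Finset γ)) → 0 ≤ corP P A B) ↔ P = univ := by
  constructor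
  · intro hcor
    exact (disjoint_refl_or_eq_univ_of_corP_nonneg hP hcor).resolve_left hnd
  · rintro rfl A B hA hB
    exact corP_univ_nonneg hA hB

end FiveUpSet

end Summit.CriticalPhenomena.PercolationContinuityZ3.Theorems
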